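/-
Copyright (c) 2026 the pub-hodgecm-mathlib formalisation cell (harness21).  Prover seat hodgecm-mathlib-R90-CS-p03 (g2), R90-TF section S8 «ContSpec-n½» (dealer R90-CS-plan (g3),
S8-R159 order «(a-7) → (a-8) → (a-10)»; census `R90/S8/CENSUS-a10-ArchNonvanishingAssembly.R90-CS-p03-g2.md`; file (a-10)): the ARCHIMEDEAN half of ★ F5's `hA32` ASSEMBLED — a
product-over-places archimedean weight whose per-place `s`-integrals have positive real part gives a NON-ZERO archimedean factor `∫_{L_∞}∫_{L⁺_∞} ω_∞·ARCH₃^{−σ}`.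
-/
import Summits.HodgeConjecture.HodgeConjecture.Theorems.K2E1ChiIntertwiningLocalFactorHolomorphicU3   -- ★ (a-3): `integral_integral_archWeight_mul_arch_cpow_neg_eq`; brings ★ `K2E1IntertwiningArchFactorIntegrableU3` (transport currency)
import Literature.NumberTheory.Automorphic.MixedSpaceUnitsMellinProduct                         -- ★ `ofReal_prod_cpow` (cast of a real product to a complex power, factor by factor)
import HarnessLib

/-!
# K2·E1 ∕ R90·S8 — `K2E1ChiArchNonvanishingAssemblyU3` (file (a-10)): PER-PLACE CORES ⟹ THE ARCHIMEDEAN FACTOR OF THE χ-INTERTWINING AMPLITUDE IS NON-ZERO —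
# `∫_{L_∞}∫_{L⁺_∞} (∏_{w∣∞} θ_w(‖Ξ_w‖, s_w))·ARCH₃(Ξ,a)^{−σ} dμ_{F,∞} dμ_{E,∞} = c·∏_{w∣∞} ∫_ℂ∫_ℝ θ_w(‖z‖,t)·((1+‖z‖²∕2)² + (wδ)²t²)^{−σ} dt dz`, `c > 0`, hence `≠ 0` when every place has `Re ∫_ℝ > 0`

Cell `pub/hodgecm-mathlib`, crux h413 = `stmt-HodgeConjecture-24833`, route of record `HCCMUnconditional`; R90-TF section S8 «ContSpec-n½», road R2-χ₃ (the (V) scalar road; ★ F5's binder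
`hA32 : A (3∕2) ≠ 0` for the ★ (a-2b)∕(a-3) amplitude `A z = C·(∫ Ξ, ∫ a, ωinf Ξ a·ARCH₃^{−z})·∏_{v∈S₀} m_v(z)`; junction J-S8-∞′ ∕ S8-R159: the archimedean weight of record is, place by
place, `(−1)^{m_w}(\bar Z_w∕|Z_w|)^{m_w}` with `Z_w = A_w + i·(wδ)·s_w`, `A_w = 1 + ‖Ξ_w‖²∕2`, `t_w = 0`, NO `X_w`-phase — a function of `(‖Ξ_w‖, s_w)` only).  THEOREMS ONLY (no `def`,
no `instance`, no notation, no named-fact hypothesis, no `sorry`; default heartbeats); lane `--supports stmt-HodgeConjecture-24833 --as helper` (count-neutral).  Closes no socket.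

THE MATHEMATICS ([MoeglinWaldspurger1995] II.1.6–II.1.7, IV.1.11; [Langlands1976] Appendix; [WeilBNT1967] Ch. IV §1).  ★ `K2E1IntertwiningArchFactorIntegrableU3` §2–§3 transports
`L_∞ × L⁺_∞` to the coordinates `(complex places of L → ℂ) × (real places of L⁺ → ℝ)` along `ringEquiv_mixedSpace` on both factors (ONE Haar constant each, ★ `isAddLeftInvariant_eq_smul`),
drops the one-point blocks, and applies Tonelli over the places; THIS FILE runs the same road for INTEGRAL IDENTITIES instead of integrability: for a weight `∏_w θ_w(‖Ξ_w‖, s_w)` with `θ_w`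
continuous of modulus `≤ 1`, `∫_{L_∞}∫_{L⁺_∞} (∏_w θ_w)·ARCH₃^{−σ} = c·∏_w I_w`, `I_w = ∫_ℂ∫_ℝ θ_w(‖z‖,t)·q_w(z,t)^{−σ} dt dz`, `q_w = (1+‖z‖²∕2)² + (wδ)²t²`, `c = c_E·c_F > 0`.  If at every place
some fixed rotation `κ_w ∈ ℂ` gives `Re(κ_w·∫_ℝ θ_w(r,t)·q_w^{−σ} dt) > 0` for all `r`, then `Re(κ_w I_w) > 0`, so `I_w ≠ 0` and the archimedean factor is `≠ 0`.  The phase weights of record with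
`|m_w| ≤ 2`, `t_w = 0` satisfy the per-place positivity by ★ (a-6) `K2E1ChiArchBetaNonvanishingU3` (its proofs ARE `Re ∫ = A·∫(A²+B²s²)^{−2} > 0`, `= B²·∫s²(A²+B²s²)^{−5∕2} > 0`); that instantiation,
at `σ = 3∕2`, is the corollary file (a-10b).
* §1 `integral_prod_placeFactors_eq` — Tonelli on `(κ₁ → ℂ) × (κ₂ → ℝ)`: `∫ ∏_i F_i(z_{e₁ i}, t_{e₂ i}) = ∏_i ∫_ℂ∫_ℝ F_i` for an integrable place-product.
* §2 `exists_pos_integral_prod_eq_smul_integral_coords` — the adelic transport: `∫_{L_∞ × L⁺_∞} Φ(‖Ξ_·‖, s_·) d(μ_{E,∞}⊗μ_{F,∞}) = c·∫_{coords} Φ`, ONE constant `c > 0` for all continuous `Φ`.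
* §3 one place: `integrable_placeFactor` (`θ(‖z‖,t)·q^{−σ} ∈ L¹(ℂ × ℝ)`), `integral_integral_placeFactor_ne_zero` (`Re(κ·∫_ℝ) > 0` for all `r` ⟹ `∫_ℂ∫_ℝ ≠ 0`).
* §4 HEAD **`integral_integral_prodWeight_mul_arch_cpow_neg_ne_zero`** — the non-vanishing under per-place rotated positivity, in ★ (a-3)'s iterated bytes at a real `σ > 1` (cast `(σ : ℂ)`).
HONEST SCOPE.  NOT here: the per-place positivity for the phase weights (corollary file (a-10b) over ★ (a-6)), `t_w ≠ 0` (complex exponents), `|m_w| ≥ 3`, and the identification «p11's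
`archSectionL` on the big cell = a weight of this product form» (p13's dictionary ∕ p11 FILE 3a).
HONEST LABEL: HC_CM is proved only modulo the 7 printed citations (2 remaining named inputs: hLiu418 = `stmt-HodgeConjecture-24832`, h413 = `stmt-HodgeConjecture-24833`) until rung 0
closes; REL ≠ ★ ≠ BUILT; this file asserts no named fact and closes no socket; count-neutral; unconditional measure theory.

## References
* [MoeglinWaldspurger1995] C. Mœglin, J.-L. Waldspurger, *Spectral Decomposition and Eisenstein Series* (1995): II.1.6–II.1.7, IV.1.11.
* [Langlands1976] R. P. Langlands, *On the Functional Equations Satisfied by Eisenstein Series*, LNM 544 (1976): Appendix (rank one).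
* [WeilBNT1967] A. Weil, *Basic Number Theory* (1967): Ch. IV §1 (Haar measure under isomorphisms).
-/

set_option autoImplicit false
set_option linter.dupNamespace false -- the mandated namespace repeats `HodgeConjecture.HodgeConjecture`

noncomputable section

open MeasureTheory MeasureTheory.Measure NumberField NumberField.InfinitePlace NumberField.mixedEmbedding IsDedekindDomain Filter Set Function Topology
open scoped NNReal ENNReal Classical
open Literature.NumberTheory.Automorphic
open Summit.HodgeConjecture.HodgeConjecture.Cruxes.H413
open Summit.HodgeConjecture.HodgeConjecture.Cruxes.H413.K2E1IntertwiningArchFactorIntegrableU3 (one_le_arch integrable_arch_rpow_neg_prod_real integrable_prod_archPlace_rpow_neg integrable_and_integral_add_mul_sq_rpow_neg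
  integrable_one_add_half_norm_sq_rpow)
open Summit.HodgeConjecture.HodgeConjecture.Cruxes.H413.K2E1IntertwiningLocalFactorIntegrableU2 (integrable_one_add_mul_sq_rpow_neg)
open Summit.HodgeConjecture.HodgeConjecture.Cruxes.H413.K2E1ChiIntertwiningLocalFactorHolomorphicU3 (integral_integral_archWeight_mul_arch_cpow_neg_eq)

namespace Summit.HodgeConjecture.HodgeConjecture.Cruxes.H413.K2E1ChiArchNonvanishingAssemblyU3

/-! ## §1 Tonelli over the places on the coordinates `(κ₁ → ℂ) × (κ₂ → ℝ)` -/

/-- **`∫_{(κ₁ → ℂ) × (κ₂ → ℝ)} ∏_i F_i(z_{e₁ i}, t_{e₂ i}) = ∏_i ∫_ℂ ∫_ℝ F_i(z, t) dt dz`** for an INTEGRABLE place-product (index bijections `e₁ : ι ≃ κ₁`, `e₂ : ι ≃ κ₂`; Mathlib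
`integral_prod` + `integral_fintype_prod_eq_prod` twice, reindexing by `Fintype.prod_equiv`). [cite: MoeglinWaldspurger1995, II.1.6] -/
theorem integral_prod_placeFactors_eq {ι κ₁ κ₂ : Type*} [Fintype ι] [Fintype κ₁] [Fintype κ₂] (e₁ : ι ≃ κ₁) (e₂ : ι ≃ κ₂) (F : ι → ℂ → ℝ → ℂ)
    (hint : Integrable (fun p : (κ₁ → ℂ) × (κ₂ → ℝ) => ∏ i, F i (p.1 (e₁ i)) (p.2 (e₂ i)))
      ((Measure.pi fun _ : κ₁ => (volume : Measure ℂ)).prod (Measure.pi fun _ : κ₂ => (volume : Measure ℝ)))) :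
    ∫ p : (κ₁ → ℂ) × (κ₂ → ℝ), ∏ i, F i (p.1 (e₁ i)) (p.2 (e₂ i)) ∂((Measure.pi fun _ : κ₁ => (volume : Measure ℂ)).prod (Measure.pi fun _ : κ₂ => (volume : Measure ℝ))) =
      ∏ i, ∫ z : ℂ, ∫ t : ℝ, F i z t := by
  rw [integral_prod _ hint]
  -- the inner `t`-integral, place by place
  have hinner : ∀ z : κ₁ → ℂ, ∫ t : κ₂ → ℝ, ∏ i, F i (z (e₁ i)) (t (e₂ i)) ∂(Measure.pi fun _ : κ₂ => (volume : Measure ℝ)) = ∏ i, ∫ s : ℝ, F i (z (e₁ i)) s := by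
    intro z
    have hre : ∀ t : κ₂ → ℝ, ∏ i, F i (z (e₁ i)) (t (e₂ i)) = ∏ k : κ₂, F (e₂.symm k) (z (e₁ (e₂.symm k))) (t k) :=
      fun t => Fintype.prod_equiv e₂ _ _ fun i => by simp only [Equiv.symm_apply_apply]
    simp_rw [hre]
    rw [integral_fintype_prod_eq_prod (f := fun k (s : ℝ) => F (e₂.symm k) (z (e₁ (e₂.symm k))) s)]
    exact (Fintype.prod_equiv e₂ _ _ fun i => by simp only [Equiv.symm_apply_apply]).symm
  simp_rw [hinner]
  -- the outer `z`-integral, place by place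
  have hre' : ∀ z : κ₁ → ℂ, ∏ i, ∫ s : ℝ, F i (z (e₁ i)) s = ∏ j : κ₁, ∫ s : ℝ, F (e₁.symm j) (z j) s :=
    fun z => Fintype.prod_equiv e₁ _ _ fun i => by simp only [Equiv.symm_apply_apply]
  simp_rw [hre']
  rw [integral_fintype_prod_eq_prod (f := fun j (X : ℂ) => ∫ s : ℝ, F (e₁.symm j) X s)]
  exact (Fintype.prod_equiv e₁ _ _ fun i => by simp only [Equiv.symm_apply_apply]).symm

/-! ## §2 The adelic transport: `L_∞ × L⁺_∞` → coordinates, ONE positive constant -/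

section Transport

variable (L : Type) [Field L] [NumberField L] [IsCMField L]
  [MeasurableSpace (InfiniteAdeleRing L)] [BorelSpace (InfiniteAdeleRing L)]
  [MeasurableSpace (InfiniteAdeleRing ↥(maximalRealSubfield L))] [BorelSpace (InfiniteAdeleRing ↥(maximalRealSubfield L))]
  (μE₁ : Measure (InfiniteAdeleRing L)) [μE₁.IsAddHaarMeasure] (μF₁ : Measure (InfiniteAdeleRing ↥(maximalRealSubfield L))) [μF₁.IsAddHaarMeasure]

/-- **THE ADELIC TRANSPORT AS AN INTEGRAL IDENTITY**: there is ONE constant `c > 0` (the product of the two Haar scalar factors of `μ_{E,∞}, μ_{F,∞}` pushed forward along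
`ringEquiv_mixedSpace`) such that for EVERY integrand `Φ(‖Ξ_·‖, s_·)` continuous in the place coordinates (`s_w(a) = ((ringEquiv_mixedSpace L⁺) a).1 ⟨w|_{L⁺}, _⟩`, ★ (a2)₃'s bytes),
`∫_{L_∞ × L⁺_∞} Φ d(μ_{E,∞} ⊗ μ_{F,∞}) = c • ∫_{(complex places of L → ℂ) × (real places of L⁺ → ℝ)} Φ(‖z_·‖, t_·) d(vol ⊗ vol)` — ★ `K2E1IntertwiningArchFactorIntegrableU3` §3's road (Haar uniqueness
`isAddLeftInvariant_eq_smul` ×2, `Measure.map_prod_map`, the one-point blocks dropped by `MeasurePreserving (Prod.map snd fst)`, `‖(ringEquiv Ξ).2 ⟨w,_⟩‖ = ‖Ξ_w‖` by the completion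
isometry), run for the INTEGRAL. [cite: WeilBNT1967, Ch. IV §1] [cite: MoeglinWaldspurger1995, II.1.6] -/
theorem exists_pos_integral_prod_eq_smul_integral_coords :
    ∃ c : ℝ≥0, 0 < c ∧ ∀ Φ : (InfinitePlace L → ℝ) → (InfinitePlace L → ℝ) → ℂ, Continuous (fun x : (InfinitePlace L → ℝ) × (InfinitePlace L → ℝ) => Φ x.1 x.2) →
      ∫ p : InfiniteAdeleRing L × InfiniteAdeleRing ↥(maximalRealSubfield L),
          Φ (fun w => ‖p.1 w‖) (fun w => ((InfiniteAdeleRing.ringEquiv_mixedSpace ↥(maximalRealSubfield L)) p.2).1 ⟨w.comap (algebraMap ↥(maximalRealSubfield L) L), K2E1HeightBigCellLineFormulaU2.isReal_comap_maximalRealSubfield L w⟩)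
          ∂(μE₁.prod μF₁) =
        (c : ℝ) • ∫ q : ({w : InfinitePlace L // w.IsComplex} → ℂ) × ({v : InfinitePlace ↥(maximalRealSubfield L) // v.IsReal} → ℝ),
          Φ (fun w => ‖q.1 ⟨w, IsTotallyComplex.isComplex w⟩‖) (fun w => q.2 ⟨w.comap (algebraMap ↥(maximalRealSubfield L) L), K2E1HeightBigCellLineFormulaU2.isReal_comap_maximalRealSubfield L w⟩) := by
  haveI : SecondCountableTopology (InfiniteAdeleRing L) := secondCountableTopology_infiniteAdeleRing L
  haveI : SecondCountableTopology (InfiniteAdeleRing ↥(maximalRealSubfield L)) := secondCountableTopology_infiniteAdeleRing _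
  -- Haar transport along `ringEquiv_mixedSpace` on both factors
  have hmeL : MeasurableEmbedding (InfiniteAdeleRing.ringEquiv_mixedSpace L) := by
    rw [← coe_infiniteAdeleRingHomeomorph]
    exact (infiniteAdeleRingHomeomorph L).measurableEmbedding
  have hmeF : MeasurableEmbedding (InfiniteAdeleRing.ringEquiv_mixedSpace ↥(maximalRealSubfield L)) := by
    rw [← coe_infiniteAdeleRingHomeomorph]
    exact (infiniteAdeleRingHomeomorph ↥(maximalRealSubfield L)).measurableEmbedding
  haveI : (μE₁.map (InfiniteAdeleRing.ringEquiv_mixedSpace L)).IsAddHaarMeasure :=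
    AddEquiv.isAddHaarMeasure_map μE₁ (InfiniteAdeleRing.ringEquiv_mixedSpace L).toAddEquiv (continuous_ringEquiv_mixedSpace L) (continuous_ringEquiv_mixedSpace_symm L)
  haveI : (μF₁.map (InfiniteAdeleRing.ringEquiv_mixedSpace ↥(maximalRealSubfield L))).IsAddHaarMeasure :=
    AddEquiv.isAddHaarMeasure_map μF₁ (InfiniteAdeleRing.ringEquiv_mixedSpace ↥(maximalRealSubfield L)).toAddEquiv (continuous_ringEquiv_mixedSpace _)
      (continuous_ringEquiv_mixedSpace_symm _)
  have hμL : μE₁.map (InfiniteAdeleRing.ringEquiv_mixedSpace L) = (μE₁.map (InfiniteAdeleRing.ringEquiv_mixedSpace L)).addHaarScalarFactor volume • volume :=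
    isAddLeftInvariant_eq_smul _ _
  have hμF : μF₁.map (InfiniteAdeleRing.ringEquiv_mixedSpace ↥(maximalRealSubfield L)) =
      (μF₁.map (InfiniteAdeleRing.ringEquiv_mixedSpace ↥(maximalRealSubfield L))).addHaarScalarFactor volume • volume :=
    isAddLeftInvariant_eq_smul _ _
  -- the one-point blocks: all places of `L` are complex, all places of `L⁺` are real
  haveI : IsEmpty {w : InfinitePlace L // w.IsReal} := ⟨fun w => (not_isReal_iff_isComplex.2 (IsTotallyComplex.isComplex w.1)) w.2⟩
  haveI : IsEmpty {v : InfinitePlace ↥(maximalRealSubfield L) // v.IsComplex} := ⟨fun v => (not_isComplex_iff_isReal.2 (IsTotallyReal.isReal v.1)) v.2⟩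
  haveI : IsProbabilityMeasure (volume : Measure ({w : InfinitePlace L // w.IsReal} → ℝ)) :=
    ⟨by rw [volume_pi, Measure.pi_univ, Fintype.prod_empty]⟩
  haveI : IsProbabilityMeasure (volume : Measure ({v : InfinitePlace ↥(maximalRealSubfield L) // v.IsComplex} → ℂ)) :=
    ⟨by rw [volume_pi, Measure.pi_univ, Fintype.prod_empty]⟩
  have hπ : MeasurePreserving (Prod.map Prod.snd Prod.fst : mixedSpace L × mixedSpace ↥(maximalRealSubfield L) → ({w : InfinitePlace L // w.IsComplex} → ℂ) × ({v : InfinitePlace ↥(maximalRealSubfield L) // v.IsReal} → ℝ))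
      ((volume : Measure (mixedSpace L)).prod (volume : Measure (mixedSpace ↥(maximalRealSubfield L)))) (volume.prod volume) :=
    (measurePreserving_snd (μ := (volume : Measure ({w : InfinitePlace L // w.IsReal} → ℝ))) (ν := (volume : Measure ({w : InfinitePlace L // w.IsComplex} → ℂ)))).prod
      (measurePreserving_fst (μ := (volume : Measure ({v : InfinitePlace ↥(maximalRealSubfield L) // v.IsReal} → ℝ))) (ν := (volume : Measure ({v : InfinitePlace ↥(maximalRealSubfield L) // v.IsComplex} → ℂ))))
  set cL : ℝ≥0 := (μE₁.map (InfiniteAdeleRing.ringEquiv_mixedSpace L)).addHaarScalarFactor volume with hcL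
  set cF : ℝ≥0 := (μF₁.map (InfiniteAdeleRing.ringEquiv_mixedSpace ↥(maximalRealSubfield L))).addHaarScalarFactor volume with hcF
  have hcLpos : 0 < cL := addHaarScalarFactor_pos_of_isAddHaarMeasure _ _
  have hcFpos : 0 < cF := addHaarScalarFactor_pos_of_isAddHaarMeasure _ _
  refine ⟨cL * cF, mul_pos hcLpos hcFpos, fun Φ hΦ => ?_⟩
  -- the integrand through the coordinates of `mixedSpace L × mixedSpace L⁺`
  set Ψ : ({w : InfinitePlace L // w.IsComplex} → ℂ) × ({v : InfinitePlace ↥(maximalRealSubfield L) // v.IsReal} → ℝ) → ℂ :=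
    fun q => Φ (fun w => ‖q.1 ⟨w, IsTotallyComplex.isComplex w⟩‖) (fun w => q.2 ⟨w.comap (algebraMap ↥(maximalRealSubfield L) L), K2E1HeightBigCellLineFormulaU2.isReal_comap_maximalRealSubfield L w⟩) with hΨ
  have hcomp : (fun p : InfiniteAdeleRing L × InfiniteAdeleRing ↥(maximalRealSubfield L) =>
        Φ (fun w => ‖p.1 w‖) (fun w => ((InfiniteAdeleRing.ringEquiv_mixedSpace ↥(maximalRealSubfield L)) p.2).1 ⟨w.comap (algebraMap ↥(maximalRealSubfield L) L), K2E1HeightBigCellLineFormulaU2.isReal_comap_maximalRealSubfield L w⟩)) =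
      fun p => (Ψ ∘ Prod.map Prod.snd Prod.fst) (Prod.map (InfiniteAdeleRing.ringEquiv_mixedSpace L) (InfiniteAdeleRing.ringEquiv_mixedSpace ↥(maximalRealSubfield L)) p) := by
    funext p
    simp only [hΨ, Function.comp_apply, Prod.map_fst, Prod.map_snd]
    congr 1
    funext w
    rw [InfiniteAdeleRing.ringEquiv_mixedSpace_apply]
    exact ((Completion.isometry_extensionEmbedding w).norm_map_of_map_zero (map_zero _) (p.1 w)).symm
  rw [hcomp, ← (hmeL.prodMap hmeF).integral_map, ← Measure.map_prod_map _ _ hmeL.measurable hmeF.measurable, hμL, hμF, Measure.prod_smul_left, Measure.prod_smul_right,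
    ENNReal.smul_def, ENNReal.smul_def, smul_smul, ← ENNReal.coe_mul, ← ENNReal.smul_def, integral_smul_nnreal_measure, NNReal.smul_def]
  congr 1
  -- drop the one-point blocks
  have hΨc : Continuous Ψ :=
    hΦ.comp ((continuous_pi fun w => continuous_norm.comp ((continuous_apply _).comp continuous_fst)).prodMk (continuous_pi fun w => (continuous_apply _).comp continuous_snd))
  rw [show (volume : Measure (({w : InfinitePlace L // w.IsComplex} → ℂ) × ({v : InfinitePlace ↥(maximalRealSubfield L) // v.IsReal} → ℝ))) = volume.prod volume from rfl, ← hπ.map_eq,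
    integral_map hπ.measurable.aemeasurable hΨc.aestronglyMeasurable]
  rfl

end Transport

/-! ## §3 One place: `I = ∫_ℂ ∫_ℝ θ(‖z‖,t)·q(z,t)^{−σ} dt dz`, `q = (1 + ‖z‖²∕2)² + c·t²` -/

section OnePlace

variable (θ : ℝ → ℝ → ℂ) (hθc : Continuous fun x : ℝ × ℝ => θ x.1 x.2) (hθb : ∀ r s, ‖θ r s‖ ≤ 1) {c σ : ℝ} (hc : 0 < c) (hσ : 1 < σ)

include hθc hθb hc hσ in
/-- **The one-place integrand `θ(‖z‖,t)·q(z,t)^{−σ}` is integrable on `ℂ × ℝ`** (`σ > 1`, `c > 0`, `‖θ‖ ≤ 1`): dominated by `q^{−σ}`, whose `t`-marginal is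
`(1+‖z‖²∕2)^{1−2σ}·c^{−½}·∫(1+u²)^{−σ}` (★ `integrable_and_integral_add_mul_sq_rpow_neg`), integrable on `ℂ` (★ `integrable_one_add_half_norm_sq_rpow`); Tonelli. [cite: Titchmarsh1939, §2.8] -/
theorem integrable_placeFactor :
    Integrable (fun p : ℂ × ℝ => θ ‖p.1‖ p.2 * ((((1 + ‖p.1‖ ^ 2 / 2) ^ 2 + c * p.2 ^ 2 : ℝ) : ℂ) ^ (-(σ : ℂ)))) ((volume : Measure ℂ).prod (volume : Measure ℝ)) := by
  have hσ' : 1 / 2 < σ := by linarith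
  have hq : ∀ (z : ℂ) (t : ℝ), 0 < (1 + ‖z‖ ^ 2 / 2) ^ 2 + c * t ^ 2 := fun z t => by positivity
  have hqc : Continuous fun p : ℂ × ℝ => (1 + ‖p.1‖ ^ 2 / 2) ^ 2 + c * p.2 ^ 2 :=
    ((continuous_const.add (((continuous_norm.comp continuous_fst).pow 2).div_const 2)).pow 2).add (continuous_const.mul (continuous_snd.pow 2))
  -- the real majorant `q^{−σ}` is integrable (Tonelli)
  have hmaj : Integrable (fun p : ℂ × ℝ => ((1 + ‖p.1‖ ^ 2 / 2) ^ 2 + c * p.2 ^ 2) ^ (-σ)) ((volume : Measure ℂ).prod (volume : Measure ℝ)) := by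
    have hmeas : AEStronglyMeasurable (fun p : ℂ × ℝ => ((1 + ‖p.1‖ ^ 2 / 2) ^ 2 + c * p.2 ^ 2) ^ (-σ)) ((volume : Measure ℂ).prod (volume : Measure ℝ)) :=
      (hqc.rpow_const fun p => Or.inl (hq _ _).ne').aestronglyMeasurable
    refine (integrable_prod_iff hmeas).2 ⟨Eventually.of_forall fun z => ?_, ?_⟩
    · exact (integrable_and_integral_add_mul_sq_rpow_neg (pow_pos (by positivity : (0 : ℝ) < 1 + ‖z‖ ^ 2 / 2) 2) hc hσ').1
    · have hmarg : ∀ z : ℂ, ∫ t : ℝ, ‖((1 + ‖z‖ ^ 2 / 2) ^ 2 + c * t ^ 2) ^ (-σ)‖ = (1 + ‖z‖ ^ 2 / 2) ^ (1 - 2 * σ) * (c ^ (-(1 / 2 : ℝ)) * ∫ u : ℝ, (1 + u ^ 2) ^ (-σ)) := by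
        intro z
        have h1 : ∫ t : ℝ, ‖((1 + ‖z‖ ^ 2 / 2) ^ 2 + c * t ^ 2) ^ (-σ)‖ = ∫ t : ℝ, ((1 + ‖z‖ ^ 2 / 2) ^ 2 + c * t ^ 2) ^ (-σ) :=
          integral_congr_ae (Eventually.of_forall fun t => Real.norm_of_nonneg (Real.rpow_nonneg (hq z t).le _))
        rw [h1, (integrable_and_integral_add_mul_sq_rpow_neg (pow_pos (by positivity : (0 : ℝ) < 1 + ‖z‖ ^ 2 / 2) 2) hc hσ').2, ← mul_assoc]
        congr 1
        rw [← Real.rpow_natCast, ← Real.rpow_mul (by positivity)]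
        congr 1
        push_cast
        ring
      exact ((integrable_one_add_half_norm_sq_rpow hσ).mul_const _).congr (Eventually.of_forall fun z => (hmarg z).symm)
  have hmeasF : AEStronglyMeasurable (fun p : ℂ × ℝ => θ ‖p.1‖ p.2 * ((((1 + ‖p.1‖ ^ 2 / 2) ^ 2 + c * p.2 ^ 2 : ℝ) : ℂ) ^ (-(σ : ℂ)))) ((volume : Measure ℂ).prod (volume : Measure ℝ)) := by
    refine ((hθc.comp ((continuous_norm.comp continuous_fst).prodMk continuous_snd)).mul ?_).aestronglyMeasurable
    exact (Complex.continuous_ofReal.comp hqc).cpow continuous_const fun p => Complex.ofReal_mem_slitPlane.2 (hq _ _)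
  refine hmaj.mono' hmeasF (Eventually.of_forall fun p => ?_)
  rw [norm_mul, Complex.norm_cpow_eq_rpow_re_of_pos (hq _ _), Complex.neg_re, Complex.ofReal_re]
  exact mul_le_of_le_one_left (Real.rpow_nonneg (hq _ _).le _) (hθb _ _)

include hθc hθb hc hσ in
/-- **ONE PLACE: `Re(κ·∫_ℝ θ(r,t) q^{−σ} dt) > 0` for all `r` ⟹ `∫_ℂ ∫_ℝ θ(‖z‖,t)·q(z,t)^{−σ} dt dz ≠ 0`** (`κ` a fixed complex rotation): the `z`-marginal is integrable (Fubini,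
`Integrable.integral_prod_left`), `Re` commutes with the integral (`integral_re`), and an integrable everywhere-positive function on `ℂ` has positive integral
(`integral_pos_iff_support_of_nonneg`, `vol(ℂ) > 0`). [cite: Titchmarsh1939, §2.8] [cite: MoeglinWaldspurger1995, IV.1.11] -/
theorem integral_integral_placeFactor_ne_zero (κ : ℂ)
    (hpos : ∀ r : ℝ, 0 < (κ * ∫ t : ℝ, θ r t * ((((1 + r ^ 2 / 2) ^ 2 + c * t ^ 2 : ℝ) : ℂ) ^ (-(σ : ℂ)))).re) :
    (∫ z : ℂ, ∫ t : ℝ, θ ‖z‖ t * ((((1 + ‖z‖ ^ 2 / 2) ^ 2 + c * t ^ 2 : ℝ) : ℂ) ^ (-(σ : ℂ)))) ≠ 0 := by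
  have hG : Integrable (fun z : ℂ => ∫ t : ℝ, θ ‖z‖ t * ((((1 + ‖z‖ ^ 2 / 2) ^ 2 + c * t ^ 2 : ℝ) : ℂ) ^ (-(σ : ℂ)))) (volume : Measure ℂ) :=
    (integrable_placeFactor θ hθc hθb hc hσ).integral_prod_left
  intro h0
  have h1 : (κ * ∫ z : ℂ, ∫ t : ℝ, θ ‖z‖ t * ((((1 + ‖z‖ ^ 2 / 2) ^ 2 + c * t ^ 2 : ℝ) : ℂ) ^ (-(σ : ℂ)))) =
      ∫ z : ℂ, κ * ∫ t : ℝ, θ ‖z‖ t * ((((1 + ‖z‖ ^ 2 / 2) ^ 2 + c * t ^ 2 : ℝ) : ℂ) ^ (-(σ : ℂ))) :=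
    (integral_const_mul κ _).symm
  have h2 : (∫ z : ℂ, κ * ∫ t : ℝ, θ ‖z‖ t * ((((1 + ‖z‖ ^ 2 / 2) ^ 2 + c * t ^ 2 : ℝ) : ℂ) ^ (-(σ : ℂ)))).re =
      ∫ z : ℂ, (κ * ∫ t : ℝ, θ ‖z‖ t * ((((1 + ‖z‖ ^ 2 / 2) ^ 2 + c * t ^ 2 : ℝ) : ℂ) ^ (-(σ : ℂ)))).re := by
    have h := integral_re (hG.const_mul κ)
    simp only [RCLike.re_to_complex] at h
    exact h.symm
  have h3 : 0 < ∫ z : ℂ, (κ * ∫ t : ℝ, θ ‖z‖ t * ((((1 + ‖z‖ ^ 2 / 2) ^ 2 + c * t ^ 2 : ℝ) : ℂ) ^ (-(σ : ℂ)))).re := by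
    have hint : Integrable (fun z : ℂ => (κ * ∫ t : ℝ, θ ‖z‖ t * ((((1 + ‖z‖ ^ 2 / 2) ^ 2 + c * t ^ 2 : ℝ) : ℂ) ^ (-(σ : ℂ)))).re) (volume : Measure ℂ) := by
      have h := (hG.const_mul κ).re
      simp only [RCLike.re_to_complex] at h
      exact h
    refine (integral_pos_iff_support_of_nonneg (fun z => (hpos ‖z‖).le) hint).2 ?_
    rw [Set.eq_univ_of_forall fun z => Function.mem_support.2 (hpos ‖z‖).ne']
    exact isOpen_univ.measure_pos _ univ_nonempty
  rw [← h2, ← h1, h0, mul_zero, Complex.zero_re] at h3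
  exact lt_irrefl _ h3

end OnePlace

/-! ## §4 HEAD: the archimedean factor of a product weight is non-zero -/

section Head

variable (L : Type) [Field L] [NumberField L] [IsCMField L] {δ : L} (hδ : δ ≠ 0)
  [MeasurableSpace (InfiniteAdeleRing L)] [BorelSpace (InfiniteAdeleRing L)]
  [MeasurableSpace (InfiniteAdeleRing ↥(maximalRealSubfield L))] [BorelSpace (InfiniteAdeleRing ↥(maximalRealSubfield L))]
  (μE₁ : Measure (InfiniteAdeleRing L)) [μE₁.IsAddHaarMeasure] (μF₁ : Measure (InfiniteAdeleRing ↥(maximalRealSubfield L))) [μF₁.IsAddHaarMeasure]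

include hδ in
/-- **HEAD.  THE ARCHIMEDEAN FACTOR OF A PRODUCT WEIGHT IS NON-ZERO.**  Let `θ_w : ℝ → ℝ → ℂ` (`w ∣ ∞` of `L`) be continuous with `‖θ_w‖ ≤ 1`, `σ > 1` real, and suppose that at
every place some fixed rotation `κ_w` makes the one-variable integrals positive: `Re(κ_w·∫_ℝ θ_w(r,t)·((1+r²∕2)² + (wδ)²t²)^{−σ} dt) > 0` for all `r`.  Then, in ★ (a-3)'s iterated
bytes with `ω_∞(Ξ,a) := ∏_w θ_w(‖Ξ_w‖, s_w(a))`,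
`∫_{L_∞} ∫_{L⁺_∞} (∏_w θ_w(‖Ξ_w‖, s_w a))·ARCH₃(Ξ,a)^{−σ} dμ_{F,∞} dμ_{E,∞} ≠ 0`.
Proof: iterated = product integral (★ (a-3)), = `c·∫_{coords}` (§2), the integrand splits as `∏_w θ_w·q_w^{−σ}` (`ofReal_prod_cpow`), Tonelli over the places (§1, dominated by ★
`integrable_prod_archPlace_rpow_neg`), and each place factor is `≠ 0` (§3).  This is the archimedean half of ★ F5's `hA32` for every weight of product form; the phase weights of
record (`t_w = 0`, `|m_w| ≤ 2`) get their per-place positivity from ★ (a-6). [cite: MoeglinWaldspurger1995, II.1.6–II.1.7, IV.1.11] [cite: Langlands1976, Appendix] [cite: WeilBNT1967, Ch. IV §1] -/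
theorem integral_integral_prodWeight_mul_arch_cpow_neg_ne_zero (θ : InfinitePlace L → ℝ → ℝ → ℂ) (hθc : ∀ w, Continuous fun x : ℝ × ℝ => θ w x.1 x.2)
    (hθb : ∀ w r s, ‖θ w r s‖ ≤ 1) {σ : ℝ} (hσ : 1 < σ)
    (hpos : ∀ w, ∃ κ : ℂ, ∀ r : ℝ, 0 < (κ * ∫ t : ℝ, θ w r t * ((((1 + r ^ 2 / 2) ^ 2 + (w δ) ^ 2 * t ^ 2 : ℝ) : ℂ) ^ (-(σ : ℂ)))).re) :
    (∫ Xi : InfiniteAdeleRing L, ∫ a : InfiniteAdeleRing ↥(maximalRealSubfield L),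
      (∏ w : InfinitePlace L, θ w ‖Xi w‖ (((InfiniteAdeleRing.ringEquiv_mixedSpace ↥(maximalRealSubfield L)) a).1 ⟨w.comap (algebraMap ↥(maximalRealSubfield L) L), K2E1HeightBigCellLineFormulaU2.isReal_comap_maximalRealSubfield L w⟩)) *
        ((((∏ w : InfinitePlace L, ((1 + ‖(Xi) w‖ ^ 2 / 2) ^ 2 + (w δ) ^ 2 * (((InfiniteAdeleRing.ringEquiv_mixedSpace ↥(maximalRealSubfield L)) a).1 ⟨w.comap (algebraMap ↥(maximalRealSubfield L) L), K2E1HeightBigCellLineFormulaU2.isReal_comap_maximalRealSubfield L w⟩) ^ 2))) : ℝ) : ℂ) ^ (-(σ : ℂ)) ∂μF₁ ∂μE₁) ≠ 0 := by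
  haveI : SecondCountableTopology (InfiniteAdeleRing L) := secondCountableTopology_infiniteAdeleRing L
  haveI : SecondCountableTopology (InfiniteAdeleRing ↥(maximalRealSubfield L)) := secondCountableTopology_infiniteAdeleRing _
  have hq : ∀ (w : InfinitePlace L) (x t : ℝ), 0 < (1 + x ^ 2 / 2) ^ 2 + (w δ) ^ 2 * t ^ 2 := fun w x t => by positivity
  have hcδ : ∀ w : InfinitePlace L, 0 < (w δ) ^ 2 := fun w => pow_pos (InfinitePlace.pos_iff.2 hδ) 2
  -- Step 1: the iterated integral is the product-measure one (★ (a-3))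
  have hωc : Continuous fun p : InfiniteAdeleRing L × InfiniteAdeleRing ↥(maximalRealSubfield L) =>
      ∏ w : InfinitePlace L, θ w ‖p.1 w‖ (((InfiniteAdeleRing.ringEquiv_mixedSpace ↥(maximalRealSubfield L)) p.2).1 ⟨w.comap (algebraMap ↥(maximalRealSubfield L) L), K2E1HeightBigCellLineFormulaU2.isReal_comap_maximalRealSubfield L w⟩) := by
    refine continuous_finsetProd _ fun w _ => (hθc w).comp (Continuous.prodMk ?_ ?_)
    · exact continuous_norm.comp ((continuous_apply w).comp continuous_fst)
    · exact (continuous_apply _).comp (continuous_fst.comp ((continuous_ringEquiv_mixedSpace ↥(maximalRealSubfield L)).comp continuous_snd))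
  have hωb : ∀ (Xi : InfiniteAdeleRing L) (a : InfiniteAdeleRing ↥(maximalRealSubfield L)),
      ‖∏ w : InfinitePlace L, θ w ‖Xi w‖ (((InfiniteAdeleRing.ringEquiv_mixedSpace ↥(maximalRealSubfield L)) a).1 ⟨w.comap (algebraMap ↥(maximalRealSubfield L) L), K2E1HeightBigCellLineFormulaU2.isReal_comap_maximalRealSubfield L w⟩)‖ ≤ 1 := fun Xi a => by
    rw [norm_prod]
    exact Finset.prod_le_one (fun w _ => norm_nonneg _) fun w _ => hθb w _ _
  have hz : 1 < ((σ : ℂ)).re := by rwa [Complex.ofReal_re]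
  rw [integral_integral_archWeight_mul_arch_cpow_neg_eq L hδ μE₁ μF₁ (fun Xi a => ∏ w : InfinitePlace L, θ w ‖Xi w‖ (((InfiniteAdeleRing.ringEquiv_mixedSpace ↥(maximalRealSubfield L)) a).1 ⟨w.comap (algebraMap ↥(maximalRealSubfield L) L), K2E1HeightBigCellLineFormulaU2.isReal_comap_maximalRealSubfield L w⟩)) hωc.aestronglyMeasurable hωb hz]
  -- Step 2: transport to the coordinates (§2)
  obtain ⟨c, hc, hcΦ⟩ := exists_pos_integral_prod_eq_smul_integral_coords L μE₁ μF₁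
  have hΦc : Continuous fun x : (InfinitePlace L → ℝ) × (InfinitePlace L → ℝ) =>
      (∏ w : InfinitePlace L, θ w (x.1 w) (x.2 w)) * ((((∏ w : InfinitePlace L, ((1 + x.1 w ^ 2 / 2) ^ 2 + (w δ) ^ 2 * x.2 w ^ 2)) : ℝ) : ℂ) ^ (-(σ : ℂ))) := by
    refine (continuous_finsetProd _ fun w _ => (hθc w).comp (((continuous_apply w).comp continuous_fst).prodMk ((continuous_apply w).comp continuous_snd))).mul ?_
    refine (Complex.continuous_ofReal.comp (continuous_finsetProd _ fun w _ => ?_)).cpow continuous_const fun x => Complex.ofReal_mem_slitPlane.2 (Finset.prod_pos fun w _ => hq w _ _)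
    exact ((continuous_const.add ((((continuous_apply w).comp continuous_fst).pow 2).div_const 2)).pow 2).add (continuous_const.mul (((continuous_apply w).comp continuous_snd).pow 2))
  rw [hcΦ (fun r s => (∏ w : InfinitePlace L, θ w (r w) (s w)) * ((((∏ w : InfinitePlace L, ((1 + r w ^ 2 / 2) ^ 2 + (w δ) ^ 2 * s w ^ 2)) : ℝ) : ℂ) ^ (-(σ : ℂ)))) hΦc]
  -- Step 3: split the integrand place by place and apply Tonelli over the places (§1)
  have hcx : ∀ w : InfinitePlace L, w.IsComplex := fun w => IsTotallyComplex.isComplex w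
  set e₁ : InfinitePlace L ≃ {w : InfinitePlace L // w.IsComplex} := (Equiv.subtypeUnivEquiv hcx).symm with he₁
  set e₂ : InfinitePlace L ≃ {v : InfinitePlace ↥(maximalRealSubfield L) // v.IsReal} :=
    (IsCMField.equivInfinitePlace L).trans (Equiv.subtypeUnivEquiv (fun v : InfinitePlace ↥(maximalRealSubfield L) => IsTotallyReal.isReal v)).symm with he₂
  have hfun : (fun q : ({w : InfinitePlace L // w.IsComplex} → ℂ) × ({v : InfinitePlace ↥(maximalRealSubfield L) // v.IsReal} → ℝ) =>
        (∏ w : InfinitePlace L, θ w ‖q.1 ⟨w, IsTotallyComplex.isComplex w⟩‖ (q.2 ⟨w.comap (algebraMap ↥(maximalRealSubfield L) L), K2E1HeightBigCellLineFormulaU2.isReal_comap_maximalRealSubfield L w⟩)) *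
          ((((∏ w : InfinitePlace L, ((1 + ‖q.1 ⟨w, IsTotallyComplex.isComplex w⟩‖ ^ 2 / 2) ^ 2 + (w δ) ^ 2 * q.2 ⟨w.comap (algebraMap ↥(maximalRealSubfield L) L), K2E1HeightBigCellLineFormulaU2.isReal_comap_maximalRealSubfield L w⟩ ^ 2)) : ℝ) : ℂ) ^ (-(σ : ℂ)))) =
      fun q => ∏ w : InfinitePlace L, θ w ‖q.1 (e₁ w)‖ (q.2 (e₂ w)) * ((((1 + ‖q.1 (e₁ w)‖ ^ 2 / 2) ^ 2 + (w δ) ^ 2 * q.2 (e₂ w) ^ 2 : ℝ) : ℂ) ^ (-(σ : ℂ))) := by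
    funext q
    rw [ofReal_prod_cpow _ _ (fun w _ => (hq w _ _).le), ← Finset.prod_mul_distrib]
    rfl
  have hint : Integrable (fun q : ({w : InfinitePlace L // w.IsComplex} → ℂ) × ({v : InfinitePlace ↥(maximalRealSubfield L) // v.IsReal} → ℝ) =>
      ∏ w : InfinitePlace L, θ w ‖q.1 (e₁ w)‖ (q.2 (e₂ w)) * ((((1 + ‖q.1 (e₁ w)‖ ^ 2 / 2) ^ 2 + (w δ) ^ 2 * q.2 (e₂ w) ^ 2 : ℝ) : ℂ) ^ (-(σ : ℂ))))
      ((Measure.pi fun _ : {w : InfinitePlace L // w.IsComplex} => (volume : Measure ℂ)).prod (Measure.pi fun _ : {v : InfinitePlace ↥(maximalRealSubfield L) // v.IsReal} => (volume : Measure ℝ))) := by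
    refine (integrable_prod_archPlace_rpow_neg e₁ e₂ (fun w : InfinitePlace L => (w δ) ^ 2) hcδ hσ).mono' ?_ (Eventually.of_forall fun q => ?_)
    · refine (continuous_finsetProd _ fun w _ => ?_).aestronglyMeasurable
      refine ((hθc w).comp ((continuous_norm.comp ((continuous_apply _).comp continuous_fst)).prodMk ((continuous_apply _).comp continuous_snd))).mul ?_
      refine (Complex.continuous_ofReal.comp ?_).cpow continuous_const fun q => Complex.ofReal_mem_slitPlane.2 (hq w _ _)
      exact ((continuous_const.add (((continuous_norm.comp ((continuous_apply _).comp continuous_fst)).pow 2).div_const 2)).pow 2).add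
        (continuous_const.mul (((continuous_apply _).comp continuous_snd).pow 2))
    · rw [norm_prod, ← Real.finsetProd_rpow _ _ (fun w _ => (hq w _ _).le)]
      refine Finset.prod_le_prod (fun w _ => norm_nonneg _) fun w _ => ?_
      rw [norm_mul, Complex.norm_cpow_eq_rpow_re_of_pos (hq w _ _), Complex.neg_re, Complex.ofReal_re]
      exact mul_le_of_le_one_left (Real.rpow_nonneg (hq w _ _).le _) (hθb w _ _)
  rw [hfun, show (volume : Measure (({w : InfinitePlace L // w.IsComplex} → ℂ) × ({v : InfinitePlace ↥(maximalRealSubfield L) // v.IsReal} → ℝ))) =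
      (Measure.pi fun _ : {w : InfinitePlace L // w.IsComplex} => (volume : Measure ℂ)).prod (Measure.pi fun _ : {v : InfinitePlace ↥(maximalRealSubfield L) // v.IsReal} => (volume : Measure ℝ)) from rfl,
    integral_prod_placeFactors_eq e₁ e₂ (fun w z t => θ w ‖z‖ t * ((((1 + ‖z‖ ^ 2 / 2) ^ 2 + (w δ) ^ 2 * t ^ 2 : ℝ) : ℂ) ^ (-(σ : ℂ)))) hint]
  -- Step 4: every place factor is non-zero (§3)
  refine smul_ne_zero (NNReal.coe_pos.2 hc).ne' (Finset.prod_ne_zero_iff.2 fun w _ => ?_)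
  obtain ⟨κ, hκ⟩ := hpos w
  exact integral_integral_placeFactor_ne_zero (θ w) (hθc w) (hθb w) (hcδ w) hσ κ hκ

end Head

end Summit.HodgeConjecture.HodgeConjecture.Cruxes.H413.K2E1ChiArchNonvanishingAssemblyU3

end
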